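import Summits.FinalStateConjecture.FinalStateConjecture.Theorems.EIHFluxBalanceInertialRecessionStubRechart3Injective
import Summits.FinalStateConjecture.FinalStateConjecture.Theorems.EIHFluxBalanceInertialRecessionStubRechart3OtherHoles

/-!
# Route EIHFluxBalance — `InertialRecession`, re-charting: coverage of the painted near zone by the clock chart

Helper file for the crux `stmt-FinalStateConjecture-10166`
(`Summit.FinalStateConjecture.FinalStateConjecture.Theses.EIHFluxBalance.InertialRecession`),
line `sublinear-is-free-clean-window-charges`, stub `stub_rechart` (the transfer P2), parts G1/G2.

The causal transfer (G2) and the identification of the exterior region need COVERAGE: every late lab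
point `x` of bounded painted radius of hole `i` is a chart point `A y` of the re-charting map, with an
explicit model point `y` (exact radius, bounded offset, lab/model time dictionary). For the honest
chart `ψ(y) = c(T) + M(T)ỹ` the preimage is explicit in space (`ỹ = (Λ̃(t)⁻¹(0, x̲ − ξ(t)))~`, the
right inverse of the purged placement, `spatial_purgedFrame_spatial_symm`) and given by the
intermediate value theorem in time (the slice function `s ↦ T₀ s + ℓ(T₀ s)ỹ` is continuous and onto).
`exists_preimage_honestChart`, `coverage_of_honest`. [folklore]
-/

noncomputable section

set_option linter.dupNamespace false

open Set Filter Function Metric Topology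
open scoped ContDiff
open Literature.Geometry.Lorentzian

namespace Summit.FinalStateConjecture.FinalStateConjecture.Theorems.SublinearIsFree.Rechart

/-- **Right inverse of the purged placement**: `(M (Λ⁻¹(0,w))~)~ = w`. [folklore] -/
theorem spatial_purgedFrame_spatial_symm (Λ : lorentzGroup) (w : E3) :
    E4.spatial (purgedFrame Λ (E4.spatial ((Λ : E4 ≃L[ℝ] E4).symm (E4.spaceEmbed w)))) = w := by
  set X : E4 := (Λ : E4 ≃L[ℝ] E4).symm (E4.spaceEmbed w) with hX
  set u : E4 := (Λ : E4 ≃L[ℝ] E4) (E4.basisVector 0) with hu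
  -- `(0, X̲) = X − X⁰ e₀`
  have hsplit : E4.ofTimeSpace 0 (E4.spatial X) = X - (X 0) • E4.basisVector 0 := by
    have h1 := E4.ofTimeSpace_eq_smul_add' (X 0) (E4.spatial X)
    have h2 : E4.ofTimeSpace (X 0) (E4.spatial X) = X := E4.ofTimeSpace_time_spatial X
    have h3 := E4.ofTimeSpace_eq_smul_add' 0 (E4.spatial X)
    rw [zero_smul, zero_add] at h3
    rw [h2] at h1
    rw [h3]
    calc E4.spaceEmbed (E4.spatial X) = ((X 0) • E4.basisVector 0 + E4.spaceEmbed (E4.spatial X)) -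
        (X 0) • E4.basisVector 0 := by abel
      _ = X - (X 0) • E4.basisVector 0 := by rw [← h1]
  have hΛz : (Λ : E4 ≃L[ℝ] E4) (E4.ofTimeSpace 0 (E4.spatial X)) = E4.spaceEmbed w - (X 0) • u := by
    rw [hsplit, map_sub, map_smul, hX, ContinuousLinearEquiv.apply_symm_apply]
  have htilt : frameTilt Λ (E4.spatial X) = -(X 0 * u 0) := by
    rw [frameTilt_apply, hΛz]
    simp [E4.spaceEmbed_apply, E4.ofTimeSpace_apply_zero, hu]
  have hu0 : u 0 ≠ 0 := frameVel_zero_ne_zero Λ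
  rw [purgedFrame_apply, hΛz, htilt, normVel, frameVel, ← hu, smul_smul]
  have hc : -(X 0 * u 0) * (u 0)⁻¹ = -(X 0) := by field_simp
  rw [hc, neg_smul, sub_neg_eq_add, sub_add_cancel, E4.spaceEmbed_apply, E4.spatial_ofTimeSpace]

section Preimage

variable (Λ : ℝ → lorentzGroup) (ξ : ℝ → E3) (T₀ : ℝ → ℝ)
  (hΛ : ContDiff ℝ ∞ (fun t ↦ ((Λ t : E4 ≃L[ℝ] E4) : E4 →L[ℝ] E4)))
  (hT₀ : ContDiff ℝ ∞ T₀) {γ : ℝ} (huγ : ∀ t, |((Λ t : E4 ≃L[ℝ] E4) (E4.basisVector 0)) 0| ≤ γ)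
  (hT₀lo : ∀ σ τ, σ ≤ τ → τ - σ ≤ T₀ τ - T₀ σ)

include hΛ hT₀ huγ hT₀lo in
/-- **Explicit preimages of the honest chart.** Every lab point `x` is `ψ y` for the model point
`y = (s, w)` with `w = (Λ̃(x⁰)⁻¹(0, x̲ − ξ(x⁰)))~` (`‖w‖ ≤ 4γ ‖x̲ − ξ(x⁰)‖`) and `s` solving
`T₀ s + ℓ(T₀ s) w = x⁰` (`|T₀ s − x⁰| ≤ 4γ‖w‖`). [folklore] -/
theorem exists_preimage_honestChart (x : E4) : ∃ y : E4, honestChart Λ ξ T₀ y = x ∧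
    ‖E4.spatial y‖ ≤ 4 * γ * ‖E4.spatial x - ξ (x 0)‖ ∧ |T₀ (y 0) - x 0| ≤ 4 * γ * ‖E4.spatial y‖ := by
  set t : ℝ := x 0 with ht
  set w : E3 := E4.spatial (((Λ t : E4 ≃L[ℝ] E4)).symm (E4.spaceEmbed (E4.spatial x - ξ t))) with hw
  have hw_norm : ‖w‖ ≤ 4 * γ * ‖E4.spatial x - ξ t‖ := by
    have h1 : ‖w‖ ≤ ‖((Λ t : E4 ≃L[ℝ] E4)).symm (E4.spaceEmbed (E4.spatial x - ξ t))‖ :=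
      (E4.spatial.le_opNorm _).trans ((mul_le_mul_of_nonneg_right norm_spatialCLM_le (norm_nonneg _)).trans
        (by rw [one_mul]))
    refine h1.trans ((((Λ t : E4 ≃L[ℝ] E4).symm : E4 →L[ℝ] E4).le_opNorm _).trans ?_)
    have h2 : ‖(((Λ t : E4 ≃L[ℝ] E4).symm : E4 ≃L[ℝ] E4) : E4 →L[ℝ] E4)‖ ≤ 4 * γ :=
      (norm_lorentz_symm_le (Λ t)).trans (by linarith [huγ t, one_le_abs_lorentz_apply_zero (Λ t)])
    have h3 : ‖E4.spaceEmbed (E4.spatial x - ξ t)‖ ≤ ‖E4.spatial x - ξ t‖ := by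
      rw [E4.spaceEmbed_apply, norm_eq_spatialNorm_of_apply_zero_eq_zero (E4.ofTimeSpace_apply_zero _ _)]
      exact (E4.spatialNorm_ofTimeSpace _ _).le
    exact mul_le_mul h2 h3 (norm_nonneg _) (by linarith [(abs_nonneg _).trans (huγ t)])
  -- the slice function and its surjectivity
  set φ : ℝ → ℝ := fun s ↦ T₀ s + frameTilt (Λ (T₀ s)) w with hφ
  have hφc : Continuous φ := by
    have h1 : Continuous fun s ↦ frameTilt (Λ (T₀ s)) := (contDiff_frameTilt Λ hΛ).continuous.comp hT₀.continuous
    exact hT₀.continuous.add (h1.clm_apply continuous_const)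
  have hbd : ∀ s, |frameTilt (Λ (T₀ s)) w| ≤ 4 * γ * ‖w‖ := fun s ↦ by
    rw [← Real.norm_eq_abs]
    refine ((frameTilt (Λ (T₀ s))).le_opNorm w).trans ?_
    exact mul_le_mul_of_nonneg_right ((norm_frameTilt_le _).trans (norm_frame_le_four_mul Λ huγ _)) (norm_nonneg _)
  have htop : Tendsto φ atTop atTop := by
    have hg : Tendsto (fun s ↦ T₀ 0 + s - 4 * γ * ‖w‖) atTop atTop :=
      tendsto_atTop_add_const_right _ _ (tendsto_atTop_add_const_left _ _ tendsto_id)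
    refine tendsto_atTop_mono' atTop ?_ hg
    filter_upwards [eventually_ge_atTop 0] with s hs
    have h1 := hbd s; have h2 := neg_abs_le (frameTilt (Λ (T₀ s)) w)
    have := hT₀lo 0 s hs
    show T₀ 0 + s - 4 * γ * ‖w‖ ≤ T₀ s + frameTilt (Λ (T₀ s)) w
    linarith
  have hbot : Tendsto φ atBot atBot := by
    have hg : Tendsto (fun s ↦ T₀ 0 + s + 4 * γ * ‖w‖) atBot atBot :=
      tendsto_atBot_add_const_right _ _ (tendsto_atBot_add_const_left _ _ tendsto_id)
    refine tendsto_atBot_mono' atBot ?_ hg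
    filter_upwards [eventually_le_atBot 0] with s hs
    have h1 := hbd s; have h2 := le_abs_self (frameTilt (Λ (T₀ s)) w)
    have := hT₀lo s 0 hs
    show T₀ s + frameTilt (Λ (T₀ s)) w ≤ T₀ 0 + s + 4 * γ * ‖w‖
    linarith
  obtain ⟨s, hs⟩ := hφc.surjective htop hbot t
  -- the preimage
  refine ⟨E4.ofTimeSpace s w, ?_, ?_, ?_⟩
  · have hT : clockMap Λ T₀ (E4.ofTimeSpace s w) = t := by
      rw [clockMap, E4.ofTimeSpace_apply_zero, E4.spatial_ofTimeSpace]; exact hs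
    rw [← E4.ofTimeSpace_time_spatial (honestChart Λ ξ T₀ (E4.ofTimeSpace s w)), E4.time_apply,
      honestChart_apply_zero, spatial_honestChart, hT, E4.spatial_ofTimeSpace, hw,
      spatial_purgedFrame_spatial_symm, add_sub_cancel, ht]
    exact E4.ofTimeSpace_time_spatial x
  · rw [E4.spatial_ofTimeSpace]; exact hw_norm
  · rw [E4.ofTimeSpace_apply_zero, E4.spatial_ofTimeSpace]
    have h1 := hbd s
    have h2 : T₀ s - t = -(frameTilt (Λ (T₀ s)) w) := by rw [← hs]; ring
    rw [h2, abs_neg]; exact h1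

end Preimage

/-- **Lab distance versus painted radius**: for `x⁰ = t`, `‖x̲ − ζ‖ ≤ r_a(Λ⁻¹(x − (t, ζ))) + |a|`
(Lorentz maps stretch spatial vectors; `‖X̲‖² ≤ r² + a²`). [folklore] -/
theorem norm_sub_le_radius_poincareInv_add (Λ : lorentzGroup) (a : ℝ) {x : E4} {t : ℝ} (hx : x 0 = t) (ζ : E3) :
    ‖E4.spatial x - ζ‖ ≤ Kerr.radius a (poincareInv Λ (E4.ofTimeSpace t ζ) x) + |a| := by
  have h := sub_abs_le_radius_poincareInv Λ a hx ζ
  linarith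

section Coverage

variable (Λ : ℝ → lorentzGroup) (ξ : ℝ → E3) (T₀ : ℝ → ℝ)
  (hΛ : ContDiff ℝ ∞ (fun t ↦ ((Λ t : E4 ≃L[ℝ] E4) : E4 →L[ℝ] E4)))
  (hT₀ : ContDiff ℝ ∞ T₀) {γ : ℝ} (hγ1 : 1 ≤ γ) (huγ : ∀ t, |((Λ t : E4 ≃L[ℝ] E4) (E4.basisVector 0)) 0| ≤ γ)
  (hT₀lo : ∀ σ τ, σ ≤ τ → τ - σ ≤ T₀ τ - T₀ σ) (a : ℝ)
  {A : E4 → E4} (hhon : ∀ K : ℝ, ∃ τK : ℝ, ∀ y : E4, τK ≤ y 0 → ‖E4.spatial y‖ ≤ K →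
    A =ᶠ[𝓝 y] honestChart Λ ξ T₀)

include hΛ hT₀ hγ1 huγ hT₀lo hhon in
/-- **Coverage of the painted near zone.** For every `R` there is a lab time `tR` such that every
lab point `x` with `tR ≤ x⁰` and painted radius `≤ R` (w.r.t. the frame `Λ̃` and centre `ξ`) is a
chart point `A y` with `y` explicit: exact radius `r_a(y) =` painted radius of `x`, offset
`‖ỹ‖ ≤ 4γ(R + |a|)`, and `|T₀(y⁰) − x⁰| ≤ 16γ²(R + |a|)`. [folklore] -/
theorem coverage_of_honest (R : ℝ) : ∃ tR : ℝ, ∀ x : E4, tR ≤ x 0 →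
    Kerr.radius a (poincareInv (Λ (x 0)) (E4.ofTimeSpace (x 0) (ξ (x 0))) x) ≤ R →
    ∃ y : E4, A y = x ∧ honestChart Λ ξ T₀ y = x ∧
      Kerr.radius a y = Kerr.radius a (poincareInv (Λ (x 0)) (E4.ofTimeSpace (x 0) (ξ (x 0))) x) ∧
      ‖E4.spatial y‖ ≤ 4 * γ * (R + |a|) ∧ |T₀ (y 0) - x 0| ≤ 16 * γ ^ 2 * (R + |a|) := by
  have hγ0 : 0 ≤ γ := zero_le_one.trans hγ1
  set K : ℝ := 4 * γ * (max R 0 + |a|) with hK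
  obtain ⟨τK, hτK⟩ := hhon K
  refine ⟨T₀ τK + 4 * γ * K, fun x hx hxR ↦ ?_⟩
  obtain ⟨y, hyx, hyw, hyt⟩ := exists_preimage_honestChart Λ ξ T₀ hΛ hT₀ huγ hT₀lo x
  -- the offset of the preimage
  have hd : ‖E4.spatial x - ξ (x 0)‖ ≤ R + |a| := by
    have h := norm_sub_le_radius_poincareInv_add (Λ (x 0)) a (x := x) rfl (ξ (x 0))
    linarith
  have hR0 : R ≤ max R 0 := le_max_left _ _
  have hyw' : ‖E4.spatial y‖ ≤ K := by
    rw [hK]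
    refine hyw.trans (mul_le_mul_of_nonneg_left (hd.trans (by linarith)) (by positivity))
  -- the model time of the preimage is late
  have hy0 : τK ≤ y 0 := by
    by_contra hlt
    push Not at hlt
    have h1 := hT₀lo (y 0) τK hlt.le
    have h2 : T₀ (y 0) ≥ x 0 - 4 * γ * ‖E4.spatial y‖ := by linarith [(abs_le.mp hyt).1]
    have h3 : 4 * γ * ‖E4.spatial y‖ ≤ 4 * γ * K := mul_le_mul_of_nonneg_left hyw' (by positivity)
    linarith
  have hAy : A y = honestChart Λ ξ T₀ y := (hτK y hy0 hyw').eq_of_nhds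
  refine ⟨y, hAy.trans hyx, hyx, ?_, ?_, ?_⟩
  · rw [← hyx, honestChart_apply_zero, radius_poincareInv_honestChart]
  · refine hyw.trans (mul_le_mul_of_nonneg_left hd (by positivity))
  · have h1 : 4 * γ * ‖E4.spatial y‖ ≤ 4 * γ * (4 * γ * (R + |a|)) :=
      mul_le_mul_of_nonneg_left (hyw.trans (mul_le_mul_of_nonneg_left hd (by positivity))) (by positivity)
    have h2 : 4 * γ * (4 * γ * (R + |a|)) = 16 * γ ^ 2 * (R + |a|) := by ring
    linarith

end Coverage

/-- Registered one-line form (worker carrier `rechart_norm_sub_le_radius_poincareInv_add`). [folklore] -/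
theorem rechart_norm_sub_le_radius_poincareInv_add : open Literature.Geometry.Lorentzian in ∀ (Λ : lorentzGroup) (a : ℝ) {x : E4} {t : ℝ}, x 0 = t → ∀ (ζ : E3), ‖E4.spatial x - ζ‖ ≤ Kerr.radius a (poincareInv Λ (E4.ofTimeSpace t ζ) x) + |a| :=
  fun Λ a _ _ hx ζ ↦ norm_sub_le_radius_poincareInv_add Λ a hx ζ

end Summit.FinalStateConjecture.FinalStateConjecture.Theorems.SublinearIsFree.Rechart

end
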